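import Literature.NumberTheory.Rogawski1990.AdelicStableClassesInvariance
import Literature.NumberTheory.Rogawski1990.AdelicStableClassSupportFiniteH
import Literature.NumberTheory.Rogawski1990.StableClassRegular
import Literature.NumberTheory.Automorphic.LocalEndoscopicOrbitClosed
import HarnessLib

/-!
# `G`-regular stable classes of the endoscopic group `H = U(J₂) × U(J₁)`: the class predicate, its representatives, and the two readings the
# engine line's anchored `SJ_H` needs (Rogawski (1990), §4.3 p. 42 «`γ′ ∈ H` is called `G`-regular if `A_{G/H}(γ′)` is a regular class in `G`»;
# §5.4 Prop. 5.4.1 p. 72; §14.5 Thm. 14.5.1 (a) p. 238)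

Topic `NumberTheory/Rogawski1990`; namespace `Literature.NumberTheory.Rogawski1990`; ONE definition with body (`StableClassH.IsGRegular`, a `Quotient.lift`)
+ theorems; no instance, no notation, no named fact, no `sorry`.  The `H`-side twin of ★ `StableClassRegular` (`StableClass.IsRegular`, F0-A-p04): cell
`pub/hodgecm-mathlib`, ENGINE T1, ED 1.19c₂ anchored kit «`SJH 𝒪H f^H := if 𝒪H is G-regular then κ_H(𝒪H) · Φ^{st,𝐀}_H(representative, …) else 0`»
(SPEC-ed1.19c §5) and pins (xiii″) ∕ (xiii-f).

* §1 (any commutative ring `S` with `σ`, forms `J₂, J₁, J₃` with `h : endoForm J₂ J₁ = J₃`): **`StableClassH.IsGRegular h 𝒪H`** — the element-level ★ `IsGRegular`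
  (`ι(γ_H)` regular semisimple in `GL₃`) descended to ★ `StableClassH` along ★ `isGRegular_of_isStablyConjH` (`G`-regularity is a stable-class function);
  `isGRegular_stableClassHOf` (`Iff.rfl`), the ∀-representative readings `IsGRegular.isGRegular_of_eq_stableClassHOf` ∕ `isGRegular_of_eq_stableClassHOf`,
  the chosen representative `stableClassHOf_out` ∕ `IsGRegular.isGRegular_out`, `isGRegular_iff_exists`, and `IsGRegular.fst_isRegular` (the `U(J₂)`-component
  class is regular, ★ `StableClass.IsRegular`, via ★ `IsGRegular.isRegularElt_fst`).
* §2 (CM dress: `L` CM, `Φ₂, Φ₁, Φ₃` the split forms, `endoForm_antidiagOne`): **`adelicStableOrbitalIntegralH_out_eq`** — for a `G`-regular class `𝒪H` and ANY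
  representative `γ_H` of it, `Φ^{st,𝐀}_H(𝒪H.out, m, f^H) = Φ^{st,𝐀}_H(γ_H, m, f^H)` (★ `adelicStableOrbitalIntegralH_eq_of_isStablyConjH`: pin (xiii″)'s
  ∀-representative form, discharged for the `out`-anchored `SJ_H` in one line); **`finite_setOf_isGRegular_and_adelicStableOrbitalIntegralH_out_ne_zero`** — for
  every class-indexed family `m` on `H(𝐀)` and every `f^H ∈ C_c`, `{𝒪H | 𝒪H G-regular ∧ Φ^{st,𝐀}_H(𝒪H.out, m, f^H) ≠ 0}` is finite (★
  `finite_setOf_stableClassH_adelicStableOrbitalIntegralH_ne_zero_cc`): pin (xiii-f) for the anchored `SJ_H` up to unfolding its `if`.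

## References
* J. D. Rogawski, *Automorphic Representations of Unitary Groups in Three Variables*, Ann. of Math. Stud. 123 (1990), §3.1 p. 19, §4.3 p. 42, §5.4
  Prop. 5.4.1 p. 72, §14.5 Thm. 14.5.1 (a) p. 238 [Rogawski1990].
-/
noncomputable section

open NumberField IsDedekindDomain

namespace Literature.NumberTheory.Rogawski1990

open Literature.NumberTheory.Automorphic
open Literature.AlgebraicGeometry.ShimuraVarieties (unitaryGroup)

/-! ## §1 The `G`-regular stable classes of `H(F) = U(J₂)(S) × U(J₁)(S)` -/

section General

variable {S : Type*} [CommRing S] {σ : S →+* S} {J₂ : Matrix (Fin 2) (Fin 2) S} {J₁ : Matrix (Fin 1) (Fin 1) S} {J₃ : Matrix (Fin 3) (Fin 3) S}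

/-- Stably conjugate pairs are `G`-regular together (★ `isGRegular_of_isStablyConjH`, both ways). [cite: Rogawski1990, §4.3 p. 42] -/
theorem IsStablyConjH.isGRegular_iff (h : endoForm J₂ J₁ = J₃) {a a' : unitaryGroup σ J₂ × unitaryGroup σ J₁} (hst : IsStablyConjH σ J₂ J₁ a a') :
    _root_.Literature.NumberTheory.Rogawski1990.IsGRegular σ J₂ J₁ J₃ h a ↔ _root_.Literature.NumberTheory.Rogawski1990.IsGRegular σ J₂ J₁ J₃ h a' :=
  ⟨isGRegular_of_isStablyConjH σ J₂ J₁ J₃ hst, isGRegular_of_isStablyConjH σ J₂ J₁ J₃ hst.symm⟩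

/-- **A stable class `𝒪′_st` of `H(F)` is `G`-REGULAR** if its elements `γ_H` are `G`-regular (★ `IsGRegular`: `ι(γ_H)` is regular semisimple in `GL₃`,
«`γ′ ∈ H` is called `G`-regular if `A_{G/H}(γ′)` is a regular class in `G`») — well defined by `IsStablyConjH.isGRegular_iff`.  These are the classes at
which Thm. 14.5.1 (a)'s `SJ(𝒪′_st, f′^H)` is the `G`-regular stable orbital integral of Prop. 5.4.1. [cite: Rogawski1990, §4.3 p. 42; §14.5 Thm. 14.5.1 (a) p. 238] -/
def StableClassH.IsGRegular (h : endoForm J₂ J₁ = J₃) : StableClassH σ J₂ J₁ → Prop :=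
  Quotient.lift (fun a : unitaryGroup σ J₂ × unitaryGroup σ J₁ => _root_.Literature.NumberTheory.Rogawski1990.IsGRegular σ J₂ J₁ J₃ h a) fun _ _ hst =>
    propext (IsStablyConjH.isGRegular_iff h hst)

/-- `𝒪′_st(γ_H)` is `G`-regular iff `γ_H` is. [cite: Rogawski1990, §4.3 p. 42] -/
@[simp] theorem StableClassH.isGRegular_stableClassHOf (h : endoForm J₂ J₁ = J₃) (a : unitaryGroup σ J₂ × unitaryGroup σ J₁) :
    (stableClassHOf σ J₂ J₁ a).IsGRegular h ↔ _root_.Literature.NumberTheory.Rogawski1990.IsGRegular σ J₂ J₁ J₃ h a :=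
  Iff.rfl

/-- **Every representative of a `G`-regular stable class is `G`-regular** (the ∀-representative form in which the engine line's pin (xiii″) quantifies).
[cite: Rogawski1990, §4.3 p. 42] -/
theorem StableClassH.IsGRegular.isGRegular_of_eq_stableClassHOf {h : endoForm J₂ J₁ = J₃} {𝒪 : StableClassH σ J₂ J₁} (h𝒪 : 𝒪.IsGRegular h)
    {a : unitaryGroup σ J₂ × unitaryGroup σ J₁} (he : 𝒪 = stableClassHOf σ J₂ J₁ a) : _root_.Literature.NumberTheory.Rogawski1990.IsGRegular σ J₂ J₁ J₃ h a := by
  rw [he] at h𝒪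
  exact h𝒪

/-- A class with one `G`-regular representative is `G`-regular. [cite: Rogawski1990, §4.3 p. 42] -/
theorem StableClassH.isGRegular_of_eq_stableClassHOf {h : endoForm J₂ J₁ = J₃} {𝒪 : StableClassH σ J₂ J₁} {a : unitaryGroup σ J₂ × unitaryGroup σ J₁}
    (he : 𝒪 = stableClassHOf σ J₂ J₁ a) (ha : _root_.Literature.NumberTheory.Rogawski1990.IsGRegular σ J₂ J₁ J₃ h a) : 𝒪.IsGRegular h := by
  rw [he]
  exact ha

/-- The chosen representative `𝒪.out` of a stable class represents it. [cite: Rogawski1990, §3.1 p. 19] -/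
@[simp] theorem StableClassH.stableClassHOf_out (𝒪 : StableClassH σ J₂ J₁) : stableClassHOf σ J₂ J₁ (Quotient.out 𝒪) = 𝒪 :=
  Quotient.out_eq 𝒪

/-- The chosen representative of `𝒪′_st(γ_H)` is stably conjugate to `γ_H`. [cite: Rogawski1990, §3.1 p. 19] -/
theorem StableClassH.isStablyConjH_out_stableClassHOf (a : unitaryGroup σ J₂ × unitaryGroup σ J₁) :
    IsStablyConjH σ J₂ J₁ (Quotient.out (stableClassHOf σ J₂ J₁ a)) a :=
  stableClassHOf_eq_iff.mp (Quotient.out_eq _)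

/-- The chosen representative of a `G`-regular class is `G`-regular. [cite: Rogawski1990, §4.3 p. 42] -/
theorem StableClassH.IsGRegular.isGRegular_out {h : endoForm J₂ J₁ = J₃} {𝒪 : StableClassH σ J₂ J₁} (h𝒪 : 𝒪.IsGRegular h) :
    _root_.Literature.NumberTheory.Rogawski1990.IsGRegular σ J₂ J₁ J₃ h (Quotient.out 𝒪) :=
  h𝒪.isGRegular_of_eq_stableClassHOf (StableClassH.stableClassHOf_out 𝒪).symm

/-- `𝒪′_st` is `G`-regular iff it has a `G`-regular representative. [cite: Rogawski1990, §4.3 p. 42] -/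
theorem StableClassH.isGRegular_iff_exists (h : endoForm J₂ J₁ = J₃) (𝒪 : StableClassH σ J₂ J₁) :
    𝒪.IsGRegular h ↔ ∃ a : unitaryGroup σ J₂ × unitaryGroup σ J₁, stableClassHOf σ J₂ J₁ a = 𝒪 ∧ _root_.Literature.NumberTheory.Rogawski1990.IsGRegular σ J₂ J₁ J₃ h a :=
  ⟨fun h𝒪 => ⟨Quotient.out 𝒪, StableClassH.stableClassHOf_out 𝒪, h𝒪.isGRegular_out⟩,
    fun ⟨_, he, ha⟩ => StableClassH.isGRegular_of_eq_stableClassHOf he.symm ha⟩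

/-- **A `G`-regular class has a regular `U(J₂)`-component class** (★ `StableClass.IsRegular`; `p_{ι(γ_H)} = p_{γ₂} · p_{γ₁}` separable ⇒ `p_{γ₂}` separable,
★ `IsGRegular.isRegularElt_fst`). [cite: Rogawski1990, §4.3 p. 42] -/
theorem StableClassH.IsGRegular.fst_isRegular {h : endoForm J₂ J₁ = J₃} {𝒪 : StableClassH σ J₂ J₁} (h𝒪 : 𝒪.IsGRegular h) : 𝒪.fst.IsRegular := by
  obtain ⟨a, rfl, ha⟩ := (StableClassH.isGRegular_iff_exists h 𝒪).mp h𝒪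
  rw [StableClassH.fst_stableClassHOf, StableClass.isRegular_stableClassOf]
  exact ha.isRegularElt_fst

end General

/-! ## §2 The CM dress: the `out`-anchored `SJ_H` reads the same at every representative, and has finite `G`-regular support -/

section CM

variable {L : Type} [Field L] [NumberField L] [IsCMField L]
  [∀ g : (UnitaryGroup.cmDatum L 2 (Matrix.of fun i j : Fin 2 => if i.val + j.val + 1 = 2 then (1 : L) else 0)).Adelic ×
      (UnitaryGroup.cmDatum L 1 (Matrix.of fun i j : Fin 1 => if i.val + j.val + 1 = 1 then (1 : L) else 0)).Adelic,
    MeasurableSpace (((UnitaryGroup.cmDatum L 2 (Matrix.of fun i j : Fin 2 => if i.val + j.val + 1 = 2 then (1 : L) else 0)).Adelic ×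
        (UnitaryGroup.cmDatum L 1 (Matrix.of fun i j : Fin 1 => if i.val + j.val + 1 = 1 then (1 : L) else 0)).Adelic) ⧸
      Subgroup.centralizer ({g} : Set ((UnitaryGroup.cmDatum L 2 (Matrix.of fun i j : Fin 2 => if i.val + j.val + 1 = 2 then (1 : L) else 0)).Adelic ×
        (UnitaryGroup.cmDatum L 1 (Matrix.of fun i j : Fin 1 => if i.val + j.val + 1 = 1 then (1 : L) else 0)).Adelic)))]

/-- **Pin (xiii″)'s anchored discharge**: for a `G`-regular stable class `𝒪H` of `H(L⁺) = U(Φ₂)(L⁺) × U(Φ₁)(L⁺)` and ANY representative `γ_H` of it, the adelic stable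
orbital integral read at the CHOSEN representative `𝒪H.out` is the one read at `γ_H` — `Φ^{st,𝐀}_H` depends only on the stable class (★
`adelicStableOrbitalIntegralH_eq_of_isStablyConjH`), for EVERY class-indexed family `m` on `H(𝐀)` and every `f^H`. [cite: Rogawski1990, §5.4 Prop. 5.4.1 p. 72] -/
theorem adelicStableOrbitalIntegralH_out_eq
    {𝒪 : StableClassH (cmConjRingHom L) (Matrix.of fun i j : Fin 2 => if i.val + j.val + 1 = 2 then (1 : L) else 0)
      (Matrix.of fun i j : Fin 1 => if i.val + j.val + 1 = 1 then (1 : L) else 0)}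
    {γH : (UnitaryGroup.cmDatum L 2 (Matrix.of fun i j : Fin 2 => if i.val + j.val + 1 = 2 then (1 : L) else 0)).Rational ×
      (UnitaryGroup.cmDatum L 1 (Matrix.of fun i j : Fin 1 => if i.val + j.val + 1 = 1 then (1 : L) else 0)).Rational}
    (he : stableClassHOf (cmConjRingHom L) _ _ γH = 𝒪)
    (m : OrbitalMeasureFamily ((UnitaryGroup.cmDatum L 2 (Matrix.of fun i j : Fin 2 => if i.val + j.val + 1 = 2 then (1 : L) else 0)).Adelic ×
      (UnitaryGroup.cmDatum L 1 (Matrix.of fun i j : Fin 1 => if i.val + j.val + 1 = 1 then (1 : L) else 0)).Adelic))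
    (fH : (UnitaryGroup.cmDatum L 2 (Matrix.of fun i j : Fin 2 => if i.val + j.val + 1 = 2 then (1 : L) else 0)).Adelic ×
      (UnitaryGroup.cmDatum L 1 (Matrix.of fun i j : Fin 1 => if i.val + j.val + 1 = 1 then (1 : L) else 0)).Adelic → ℂ) :
    adelicStableOrbitalIntegralH L (Quotient.out 𝒪) m fH = adelicStableOrbitalIntegralH L γH m fH := by
  subst he
  exact adelicStableOrbitalIntegralH_eq_of_isStablyConjH L (StableClassH.isStablyConjH_out_stableClassHOf γH) m fH

/-- **Pin (xiii-f)'s anchored discharge (up to unfolding the `if`)**: for EVERY class-indexed family `m` on `H(𝐀)` and every `f^H ∈ C_c(H(𝐀), ℂ)`, only finitely many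
`G`-regular stable classes `𝒪H` have `Φ^{st,𝐀}_H(𝒪H.out, m, f^H) ≠ 0` (★ `finite_setOf_stableClassH_adelicStableOrbitalIntegralH_ne_zero_cc`, at the `G`-regular
representative `𝒪H.out`). [cite: Rogawski1990, §5.4 pp. 72–73; §14.5 Thm. 14.5.1 (a) p. 238] -/
theorem finite_setOf_isGRegular_and_adelicStableOrbitalIntegralH_out_ne_zero
    (m : OrbitalMeasureFamily ((UnitaryGroup.cmDatum L 2 (Matrix.of fun i j : Fin 2 => if i.val + j.val + 1 = 2 then (1 : L) else 0)).Adelic ×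
      (UnitaryGroup.cmDatum L 1 (Matrix.of fun i j : Fin 1 => if i.val + j.val + 1 = 1 then (1 : L) else 0)).Adelic))
    (fH : CompactlySupportedContinuousMap ((UnitaryGroup.cmDatum L 2 (Matrix.of fun i j : Fin 2 => if i.val + j.val + 1 = 2 then (1 : L) else 0)).Adelic ×
      (UnitaryGroup.cmDatum L 1 (Matrix.of fun i j : Fin 1 => if i.val + j.val + 1 = 1 then (1 : L) else 0)).Adelic) ℂ) :
    {𝒪H : StableClassH (cmConjRingHom L) (Matrix.of fun i j : Fin 2 => if i.val + j.val + 1 = 2 then (1 : L) else 0)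
        (Matrix.of fun i j : Fin 1 => if i.val + j.val + 1 = 1 then (1 : L) else 0) |
      𝒪H.IsGRegular endoForm_antidiagOne ∧ adelicStableOrbitalIntegralH L (Quotient.out 𝒪H) m fH ≠ 0}.Finite := by
  refine (finite_setOf_stableClassH_adelicStableOrbitalIntegralH_ne_zero_cc (L := L) m fH).subset ?_
  rintro 𝒪H ⟨hreg, hne⟩
  exact ⟨Quotient.out 𝒪H, StableClassH.stableClassHOf_out 𝒪H, hreg.isGRegular_out, hne⟩

/-- The same with the `if` of the anchored `SJ_H` spelled out: for any constants `κ : 𝒪H ↦ ℂ`, the support of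
`𝒪H ↦ if 𝒪H is G-regular then κ 𝒪H · Φ^{st,𝐀}_H(𝒪H.out, m, f^H) else 0` is finite. [cite: Rogawski1990, §14.5 Thm. 14.5.1 (a) p. 238] -/
theorem finite_support_ite_isGRegular_mul_adelicStableOrbitalIntegralH_out
    (κ : StableClassH (cmConjRingHom L) (Matrix.of fun i j : Fin 2 => if i.val + j.val + 1 = 2 then (1 : L) else 0)
        (Matrix.of fun i j : Fin 1 => if i.val + j.val + 1 = 1 then (1 : L) else 0) → ℂ)
    (m : OrbitalMeasureFamily ((UnitaryGroup.cmDatum L 2 (Matrix.of fun i j : Fin 2 => if i.val + j.val + 1 = 2 then (1 : L) else 0)).Adelic ×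
      (UnitaryGroup.cmDatum L 1 (Matrix.of fun i j : Fin 1 => if i.val + j.val + 1 = 1 then (1 : L) else 0)).Adelic))
    (fH : CompactlySupportedContinuousMap ((UnitaryGroup.cmDatum L 2 (Matrix.of fun i j : Fin 2 => if i.val + j.val + 1 = 2 then (1 : L) else 0)).Adelic ×
      (UnitaryGroup.cmDatum L 1 (Matrix.of fun i j : Fin 1 => if i.val + j.val + 1 = 1 then (1 : L) else 0)).Adelic) ℂ)
    [DecidablePred fun 𝒪H : StableClassH (cmConjRingHom L) (Matrix.of fun i j : Fin 2 => if i.val + j.val + 1 = 2 then (1 : L) else 0)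
        (Matrix.of fun i j : Fin 1 => if i.val + j.val + 1 = 1 then (1 : L) else 0) => 𝒪H.IsGRegular endoForm_antidiagOne] :
    (Function.support fun 𝒪H : StableClassH (cmConjRingHom L) (Matrix.of fun i j : Fin 2 => if i.val + j.val + 1 = 2 then (1 : L) else 0)
        (Matrix.of fun i j : Fin 1 => if i.val + j.val + 1 = 1 then (1 : L) else 0) =>
      if 𝒪H.IsGRegular endoForm_antidiagOne then κ 𝒪H * adelicStableOrbitalIntegralH L (Quotient.out 𝒪H) m fH else 0).Finite := by
  refine (finite_setOf_isGRegular_and_adelicStableOrbitalIntegralH_out_ne_zero (L := L) m fH).subset ?_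
  intro 𝒪H h𝒪H
  rw [Function.mem_support] at h𝒪H
  by_cases hreg : 𝒪H.IsGRegular endoForm_antidiagOne
  · rw [if_pos hreg] at h𝒪H
    exact ⟨hreg, fun h0 => h𝒪H (by rw [h0, mul_zero])⟩
  · exact absurd (if_neg hreg) h𝒪H

end CM

end Literature.NumberTheory.Rogawski1990
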